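import Summits.BirchSwinnertonDyer.BirchSwinnertonDyer.Theorems.ManinLocalTwoThreeNewformFortyEight
import Literature.NumberTheory.EllipticCurves.NewformsOldNewProofs
import Literature.NumberTheory.EllipticCurves.ModularFormsGamma0Genus
import HarnessLib

/-!
# Level 48 (`4 ∣ 48`, genus `3`), part 2: the newform of every `X₀(48)`-datum is `φ₄₈` — FACT-FREE newform
# pinning beyond genus one — and the cuspidal Sturm bound at level `48`

Cell bsd-f2-manin, route `ManinLocalTwoThree` (crux C2 `ManinOddAtFour`, stmt-22967), prover seat p2 gen 26; sequel to
`…NewformFortyEight` (`φ₄₈` is killed by both adjoint degeneracy maps to level `24`).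

* §4 `φ₄₈ ∈ S₂(Γ₀(48))^{new}` (the remaining adjoint degeneracy maps land in `S₂(Γ₀(M)) = 0`, `M ∣ 48`, `M ∉ {24, 48}`,
  tree `finrank_cuspForm_two_eq_genusX0_holds` at the genus-`0` levels).
* §5 `μ(48) = 96`, `ν_∞ = 12`, `g(X₀(48)) = 3 = dim S₂(Γ₀(48))`; the old subspace contains the independent
  `f₂₄` and `f₂₄|diag(2,1) = 2η₄η₈η₁₂η₂₄` (orders `1`, `2` at `∞`); old and new are disjoint (tree
  `disjoint_oldSubspace0_newSubspace0_holds`) ⟹ `dim new ≤ 1` ⟹ `S₂(Γ₀(48))^{new} = ℂφ₄₈` ⟹ **every newform of level `48`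
  is `φ₄₈`, so `D.f = φ₄₈` for every `X₀(48)`-datum `D` of every curve** (`f_apply_eq_phi48`) — the first newform pinning
  of the cell beyond the genus-one levels, with no printed fact.
* §6 The cuspidal Sturm bound at level `48` (tree `coe_eq_zero_of_isBigO_exp`: `⌊2·96/12⌋ + 1 = 17 < 6 + 12`):
  `S ∈ S₂(Γ₀(48))` with `S/q⁶` convergent at `i∞` vanishes (the vanishing criterion for the `η`-identities at `48`).

No definition, no named fact, no sorry.  Nothing here proves C2, Manin's conjecture or BSD.
[cite: AtkinLehner1970, Thm. 5] [cite: DiamondShurman2005, §5.6, Thm. 3.5.1] [cite: CremonaAlgorithms1997, Table 3 (N = 48)]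
-/

set_option autoImplicit false
-- lint-debt: the directory name repeats the summit name (sibling precedent `ManinLocalTwoThreeNewformFortyEight.lean`)
set_option linter.dupNamespace false

noncomputable section

open Complex Filter Topology Set Function Asymptotics
open UpperHalfPlane hiding I
open scoped Real Topology Manifold MatrixGroups ModularForm
open ModularForm CongruenceSubgroup Matrix.SpecialLinearGroup
open Literature.NumberTheory.ModularForms
open Literature.NumberTheory.EllipticCurves Literature.NumberTheory.EllipticCurves.ModularForms

namespace Summit.BirchSwinnertonDyer.BirchSwinnertonDyer.Theorems.ManinLocalTwoThree.NewformFortyEight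

open CuspToolkit

/-! ## §4 `φ₄₈` is new -/

/-- `S₂(Γ₀(M)) = 0` for `M ∣ 48`, `M ∉ {24, 48}` (`M ∈ {1,2,3,4,6,8,12,16}`, genus `0`). [cite: DiamondShurman2005, Thm. 3.5.1] -/
theorem cuspForm_two_eq_zero_of_mem_properDivisors_fortyEight {M : ℕ} [NeZero M]
    (hM : M ∈ Nat.properDivisors 48) (hM24 : M ≠ 24) (g : CuspForm (Gamma0 M) 2) : g = 0 := by
  have hfd : FiniteDimensional ℂ (CuspForm (Gamma0 M) 2) := finiteDimensional_cuspForm_gamma0 M 2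
  rw [show Nat.properDivisors 48 = {1, 2, 3, 4, 6, 8, 12, 16, 24} by decide] at hM
  simp only [Finset.mem_insert, Finset.mem_singleton] at hM
  have h1 : finrank_cuspForm_two_eq_genusX0 M := finrank_cuspForm_two_eq_genusX0_holds M
  have h2 : genusX0 M = 0 :=
    genusX0_eq_zero_of_mem_genusZeroLevels (by simp only [Finset.mem_insert, Finset.mem_singleton]; omega)
  unfold finrank_cuspForm_two_eq_genusX0 at h1
  rw [h2] at h1
  exact (finrank_zero_iff_forall_zero.mp h1) g

/-- **`φ₄₈ ∈ S₂(Γ₀(48))^{new}`** (joint kernel of all adjoint degeneracy maps) — FACT-FREE. [cite: AtkinLehner1970, Thm. 5] -/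
theorem mem_newSubspace0_phi48 (φ : CuspForm (Gamma0 48) 2)
    (hφ : ⇑φ = etaQuotient 48 (expFn [(2, -1), (4, 4), (6, -1), (8, -1), (12, 4), (24, -1)])) :
    φ ∈ newSubspace0 48 2 := by
  rw [newSubspace0, Submodule.mem_iInf]
  rintro ⟨⟨M, d⟩, hM, hMd⟩
  haveI hM0 : NeZero M := ⟨(Nat.pos_of_mem_properDivisors hM).ne'⟩
  haveI hd0 : NeZero d := ⟨fun h ↦ by simp [h] at hMd⟩
  haveI : NeZero (M, d).1 := hM0
  haveI : NeZero (M, d).2 := hd0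
  rw [LinearMap.mem_ker]
  dsimp only
  by_cases hM24 : M = 24
  · subst hM24
    have hd : d = 1 ∨ d = 2 := by
      have hd2 : d ∣ 2 := by
        have h48 : (24 * d) ∣ 24 * 2 := hMd
        exact Nat.dvd_of_mul_dvd_mul_left (by norm_num) h48
      have hdle := Nat.le_of_dvd two_pos hd2
      interval_cases d
      · exact absurd hd2 (by decide)
      · exact Or.inl rfl
      · exact Or.inr rfl
    rcases hd with rfl | rfl
    · exact adjDegeneracyMap0_one_phi48 φ hφ
    · exact adjDegeneracyMap0_two_phi48 φ hφ
  · exact cuspForm_two_eq_zero_of_mem_properDivisors_fortyEight hM hM24 _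

/-! ## §5 `dim S₂(Γ₀(48)) = 3`, the old part has dimension `≥ 2`, so every newform of level `48` is `φ₄₈` -/

/-- `μ(Γ₀(48)) = 96`, `ν_∞ = 12`, `ν₂ = ν₃ = 0` (Diamond–Shurman Figure 3.3, §3.8). [cite: DiamondShurman2005, §3.8] -/
theorem gamma0_data_48 : gamma0Index 48 = 96 ∧ nuInfty 48 = 12 ∧ nu₂ 48 = 0 ∧ nu₃ 48 = 0 :=
  ⟨(gamma0Index_mul (m := 16) (n := 3) (by norm_num)).trans
      (by rw [show (16 : ℕ) = 2 ^ 4 by norm_num, gamma0Index_prime_pow (p := 2) (e := 4) Nat.prime_two (by norm_num),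
        gamma0Index_prime Nat.prime_three]; norm_num),
    by decide, by rw [nu₂_eq_card]; decide, by rw [nu₃_eq_card]; decide⟩

/-- `g(X₀(48)) = 3`. [cite: DiamondShurman2005, Thm. 3.1.1] -/
theorem genusX0_fortyEight : genusX0 48 = 3 := by
  obtain ⟨h1, h2, h3, h4⟩ := gamma0_data_48
  rw [genusX0, h1, h2, h3, h4]

/-- **`dim S₂(Γ₀(48)) = 3`.** [cite: DiamondShurman2005, Thm. 3.5.1] -/
theorem finrank_cuspForm_two_fortyEight : Module.finrank ℂ (CuspForm (Gamma0 48) 2) = 3 := by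
  have h := finrank_cuspForm_two_eq_genusX0_holds 48
  unfold finrank_cuspForm_two_eq_genusX0 at h
  rw [h, genusX0_fortyEight]

/-- `ι₁ f₂₄ = f₂₄` pointwise (degeneracy map at `d = 1`). [cite: DiamondShurman2005, §5.6] -/
theorem degeneracyMap0_one_eta24_apply (τ : ℍ) : degeneracyMap0 24 48 1 2 cuspFormEta24 τ = cuspFormEta24 τ :=
  congr_fun (coe_degeneracyMap0_one 24 48 2 (by norm_num) cuspFormEta24) τ

/-- The exponents of `η₄η₈η₁₂η₂₄ = f₂₄(2τ)` at the divisors of `48`. [folklore] -/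
theorem expFn_eta24B2_values :
    expFn [(4, 1), (8, 1), (12, 1), (24, 1)] 1 = 0 ∧ expFn [(4, 1), (8, 1), (12, 1), (24, 1)] 2 = 0 ∧
    expFn [(4, 1), (8, 1), (12, 1), (24, 1)] 3 = 0 ∧ expFn [(4, 1), (8, 1), (12, 1), (24, 1)] 4 = 1 ∧
    expFn [(4, 1), (8, 1), (12, 1), (24, 1)] 6 = 0 ∧ expFn [(4, 1), (8, 1), (12, 1), (24, 1)] 8 = 1 ∧
    expFn [(4, 1), (8, 1), (12, 1), (24, 1)] 12 = 1 ∧ expFn [(4, 1), (8, 1), (12, 1), (24, 1)] 16 = 0 ∧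
    expFn [(4, 1), (8, 1), (12, 1), (24, 1)] 24 = 1 ∧ expFn [(4, 1), (8, 1), (12, 1), (24, 1)] 48 = 0 := by
  decide

/-- `ι₂ f₂₄ = 2·η₄η₈η₁₂η₂₄` pointwise (degeneracy map at `d = 2`: `f ↦ 2f(2τ)`). [cite: DiamondShurman2005, §5.6] -/
theorem degeneracyMap0_two_eta24_apply (τ : ℍ) :
    degeneracyMap0 24 48 2 2 cuspFormEta24 τ = 2 * etaQuotient 48 (expFn [(4, 1), (8, 1), (12, 1), (24, 1)]) τ := by
  obtain ⟨a1, a2, a3, a4, a6, a8, a12, a16, a24, a48⟩ := expFn_eta24B2_values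
  obtain ⟨c1, c2, c3, c4, c6, c8, c12, c24⟩ := expFn_etaList24_values
  rw [congr_fun (coe_degeneracyMap0 24 48 2 2 (by norm_num) cuspFormEta24) τ, slash_tpD_apply,
    show (cuspFormEta24 (tpD 2 • τ) : ℂ) = etaQuotient 24 (expFn etaList24) (tpD 2 • τ) from rfl,
    etaQuotient, etaQuotient, etaQuotientC, etaQuotientC, coe_tpD_smul,
    show Nat.divisors 48 = {1, 2, 3, 4, 6, 8, 12, 16, 24, 48} by decide,
    show Nat.divisors 24 = {1, 2, 3, 4, 6, 8, 12, 24} by decide]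
  rw [Finset.prod_insert (by decide), Finset.prod_insert (by decide), Finset.prod_insert (by decide),
    Finset.prod_insert (by decide), Finset.prod_insert (by decide), Finset.prod_insert (by decide),
    Finset.prod_insert (by decide), Finset.prod_singleton,
    Finset.prod_insert (by decide), Finset.prod_insert (by decide), Finset.prod_insert (by decide),
    Finset.prod_insert (by decide), Finset.prod_insert (by decide), Finset.prod_insert (by decide),
    Finset.prod_insert (by decide), Finset.prod_insert (by decide), Finset.prod_insert (by decide),
    Finset.prod_singleton]
  rw [a1, a2, a3, a4, a6, a8, a12, a16, a24, a48, c1, c2, c3, c4, c6, c8, c12, c24]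
  simp only [zpow_zero, zpow_one, one_mul, mul_one]
  have e4 : ((2 : ℕ) : ℂ) * (((2 : ℕ) : ℂ) * (τ : ℂ)) = ((4 : ℕ) : ℂ) * (τ : ℂ) := by push_cast; ring
  have e8 : ((4 : ℕ) : ℂ) * (((2 : ℕ) : ℂ) * (τ : ℂ)) = ((8 : ℕ) : ℂ) * (τ : ℂ) := by push_cast; ring
  have e12 : ((6 : ℕ) : ℂ) * (((2 : ℕ) : ℂ) * (τ : ℂ)) = ((12 : ℕ) : ℂ) * (τ : ℂ) := by push_cast; ring
  have e24 : ((12 : ℕ) : ℂ) * (((2 : ℕ) : ℂ) * (τ : ℂ)) = ((24 : ℕ) : ℂ) * (τ : ℂ) := by push_cast; ring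
  rw [e4, e8, e12, e24]
  norm_num

/-- `ι₂ f₂₄ / q² → 2` at `i∞`. [folklore] -/
theorem tendsto_degeneracyMap0_two_eta24_div :
    Tendsto (fun τ : ℍ ↦ degeneracyMap0 24 48 2 2 cuspFormEta24 τ / Periodic.qParam 1 (τ : ℂ) ^ (2 : ℤ))
      atImInfty (𝓝 2) := by
  have h := (tendsto_etaQuotient_div_qParam_zpow 48 (expFn [(4, 1), (8, 1), (12, 1), (24, 1)]) 2 (by decide)).const_mul 2
  rw [mul_one] at h
  refine h.congr fun τ ↦ ?_
  rw [degeneracyMap0_two_eta24_apply, mul_div_assoc]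

/-- `ι₂ f₂₄ ≠ 0`. [folklore] -/
theorem degeneracyMap0_two_eta24_ne_zero : degeneracyMap0 24 48 2 2 cuspFormEta24 ≠ 0 := by
  intro h
  have h1 := congrArg (fun f : CuspForm (Gamma0 48) 2 ↦ f UpperHalfPlane.I) h
  simp only [CuspForm.zero_apply, degeneracyMap0_two_eta24_apply, mul_eq_zero, OfNat.ofNat_ne_zero, false_or] at h1
  exact etaQuotient_ne_zero 48 _ _ h1

/-- **`ι₁f₂₄`, `ι₂f₂₄` are linearly independent** (orders `1` and `2` at `∞`). [folklore] -/
theorem degeneracy_images_independent (a b : ℂ)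
    (h : a • degeneracyMap0 24 48 1 2 cuspFormEta24 + b • degeneracyMap0 24 48 2 2 cuspFormEta24 = 0) :
    a = 0 ∧ b = 0 := by
  -- divide by `q`: `a·(f₂₄/q) + b·(ι₂f₂₄/q²)·q → a·1 + b·2·0`
  have hq : Tendsto (fun τ : ℍ ↦ Periodic.qParam 1 (τ : ℂ)) atImInfty (𝓝 0) := by
    simpa only [zpow_one] using tendsto_qParam_zpow_atImInfty (m := 1) (by norm_num)
  have hlim := (EtaIdentityReductionTwentyFour.tendsto_eta24_div_qParam.const_mul a).add
    ((tendsto_degeneracyMap0_two_eta24_div.const_mul b).mul hq)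
  rw [mul_one, mul_zero, add_zero] at hlim
  have hzero : Tendsto (fun τ : ℍ ↦ a * (cuspFormEta24 τ / Periodic.qParam 1 (τ : ℂ))
      + b * (degeneracyMap0 24 48 2 2 cuspFormEta24 τ / Periodic.qParam 1 (τ : ℂ) ^ (2 : ℤ))
        * Periodic.qParam 1 (τ : ℂ)) atImInfty (𝓝 0) := by
    refine tendsto_const_nhds.congr fun τ ↦ ?_
    have hτ := congrArg (fun f : CuspForm (Gamma0 48) 2 ↦ f τ) h
    simp only [CuspForm.add_apply, CuspForm.IsGLPos.smul_apply, smul_eq_mul, CuspForm.zero_apply,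
      degeneracyMap0_one_eta24_apply] at hτ
    have hq0 : Periodic.qParam 1 (τ : ℂ) ≠ 0 := Complex.exp_ne_zero _
    field_simp
    linear_combination -hτ
  have ha : a = 0 := tendsto_nhds_unique hlim hzero
  refine ⟨ha, ?_⟩
  rw [ha, zero_smul, zero_add] at h
  rcases smul_eq_zero.mp h with hb | hb
  · exact hb
  · exact absurd hb degeneracyMap0_two_eta24_ne_zero

/-- `ι_d f₂₄ ∈ S₂(Γ₀(48))^{old}` for `d = 1, 2`. [cite: AtkinLehner1970, §2] -/
theorem degeneracyMap0_eta24_mem_old (d : ℕ) [NeZero d] (hd : d = 1 ∨ d = 2) :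
    degeneracyMap0 24 48 d 2 cuspFormEta24 ∈ oldSubspace0 48 2 := by
  have hidx : (24, d) ∈ {x : ℕ × ℕ | x.1 ∈ Nat.properDivisors 48 ∧ x.1 * x.2 ∣ 48} := by
    rcases hd with rfl | rfl <;> decide
  rw [oldSubspace0]
  exact Submodule.mem_iSup_of_mem ⟨(24, d), hidx⟩ (LinearMap.mem_range_self _ _)

/-- **`dim S₂(Γ₀(48))^{old} ≥ 2`.** [cite: AtkinLehner1970, §2] -/
theorem two_le_finrank_oldSubspace0 : 2 ≤ Module.finrank ℂ (oldSubspace0 48 2) := by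
  haveI : FiniteDimensional ℂ (CuspForm (Gamma0 48) 2) := finiteDimensional_cuspForm_gamma0 48 2
  have hv : LinearIndependent ℂ
      ![(⟨degeneracyMap0 24 48 1 2 cuspFormEta24, degeneracyMap0_eta24_mem_old 1 (Or.inl rfl)⟩ : oldSubspace0 48 2),
        ⟨degeneracyMap0 24 48 2 2 cuspFormEta24, degeneracyMap0_eta24_mem_old 2 (Or.inr rfl)⟩] := by
    rw [LinearIndependent.pair_iff]
    intro s t hst
    have h' := congrArg Subtype.val hst
    simp only [Submodule.coe_add, Submodule.coe_smul, Submodule.coe_zero] at h'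
    exact degeneracy_images_independent s t h'
  simpa using hv.fintype_card_le_finrank

/-- **`dim S₂(Γ₀(48))^{new} ≤ 1`** (`old ⊓ new = 0`, `dim old ≥ 2`, `dim = 3`). [cite: AtkinLehner1970, Thm. 5] -/
theorem finrank_newSubspace0_le_one : Module.finrank ℂ (newSubspace0 48 2) ≤ 1 := by
  haveI : FiniteDimensional ℂ (CuspForm (Gamma0 48) 2) := finiteDimensional_cuspForm_gamma0 48 2
  have hsum := Submodule.finrank_sup_add_finrank_inf_eq (oldSubspace0 48 2) (newSubspace0 48 2)
  have hdisj : oldSubspace0 48 2 ⊓ newSubspace0 48 2 = ⊥ :=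
    disjoint_iff.mp (disjoint_oldSubspace0_newSubspace0_holds (N := 48) (k := 2))
  rw [hdisj, finrank_bot, add_zero] at hsum
  have hle : Module.finrank ℂ ↥(oldSubspace0 48 2 ⊔ newSubspace0 48 2) ≤ 3 :=
    finrank_cuspForm_two_fortyEight ▸ Submodule.finrank_le _
  have h2 := two_le_finrank_oldSubspace0
  omega

/-- **Every element of `S₂(Γ₀(48))^{new}` is a multiple of `φ₄₈`.** [cite: AtkinLehner1970, Thm. 5] -/
theorem exists_eq_smul_phi48_of_mem_new (φ : CuspForm (Gamma0 48) 2)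
    (hφ : ⇑φ = etaQuotient 48 (expFn [(2, -1), (4, 4), (6, -1), (8, -1), (12, 4), (24, -1)]))
    {g : CuspForm (Gamma0 48) 2} (hg : g ∈ newSubspace0 48 2) : ∃ c : ℂ, c • φ = g := by
  haveI : FiniteDimensional ℂ (CuspForm (Gamma0 48) 2) := finiteDimensional_cuspForm_gamma0 48 2
  have hφn : (⟨φ, mem_newSubspace0_phi48 φ hφ⟩ : newSubspace0 48 2) ≠ 0 := by
    intro h
    exact phi48_ne_zero φ hφ (congrArg Subtype.val h)
  have h1 : Module.finrank ℂ (newSubspace0 48 2) = 1 := by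
    refine le_antisymm finrank_newSubspace0_le_one ?_
    rw [Nat.one_le_iff_ne_zero, Ne, finrank_zero_iff_forall_zero, not_forall]
    exact ⟨_, hφn⟩
  obtain ⟨c, hc⟩ := (finrank_eq_one_iff_of_nonzero' _ hφn).mp h1 ⟨g, hg⟩
  exact ⟨c, by simpa using congrArg Subtype.val hc⟩

/-- **Every newform of weight `2` on `Γ₀(48)` is `φ₄₈`** — FACT-FREE. [cite: CremonaAlgorithms1997, Table 3 (N = 48)] -/
theorem eq_phi48_of_isNewform0 (φ : CuspForm (Gamma0 48) 2)
    (hφ : ⇑φ = etaQuotient 48 (expFn [(2, -1), (4, 4), (6, -1), (8, -1), (12, 4), (24, -1)]))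
    {g : CuspForm (Gamma0 48) 2} (hg : IsNewform0 g) : g = φ := by
  obtain ⟨c, hc⟩ := exists_eq_smul_phi48_of_mem_new φ hφ hg.1
  have h1 : cuspCoeff g 1 = 1 := hg.2.2
  have hc1 : c = 1 := by
    have h := congrArg (cuspCoeff · 1) hc
    simp only [cuspCoeff_smul, h1, cuspCoeff_one_phi48 φ hφ, mul_one] at h
    exact h
  rw [← hc, hc1, one_smul]

/-- **Every `X₀(48)`-datum of every curve has newform `φ₄₈`** (as cusp forms). FACT-FREE. [cite: CremonaAlgorithms1997, Table 3 (N = 48)] -/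
theorem f_eq_phi48 (φ : CuspForm (Gamma0 48) 2)
    (hφ : ⇑φ = etaQuotient 48 (expFn [(2, -1), (4, 4), (6, -1), (8, -1), (12, 4), (24, -1)]))
    {W : WeierstrassCurve ℚ} (D : ModularParametrizationData W 48) : D.f = φ :=
  eq_phi48_of_isNewform0 φ hφ D.isNewformOf.1

/-- **Every `X₀(48)`-datum of every curve has newform `φ₄₈ = η₄⁴η₁₂⁴/(η₂η₆η₈η₂₄)`** (pointwise, definition-free form).
FACT-FREE. [cite: CremonaAlgorithms1997, Table 3 (N = 48)] -/
theorem f_apply_eq_phi48 {W : WeierstrassCurve ℚ} (D : ModularParametrizationData W 48) :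
    ⇑D.f = etaQuotient 48 (expFn [(2, -1), (4, 4), (6, -1), (8, -1), (12, 4), (24, -1)]) := by
  obtain ⟨φ, hφ⟩ := exists_cuspForm_phi48
  rw [f_eq_phi48 φ hφ D, hφ]

/-! ## §6 The cuspidal Sturm bound at level `48`: `S = O(q⁶) ⟹ S = 0` -/

/-- **`S ∈ S₂(Γ₀(48))` with `S = O(e^{−12π Im τ})` at `i∞` vanishes** (`⌊2·96/12⌋ + 1 = 17 < 6 + 12`).
[cite: DiamondShurman2005, Thm. 3.5.1] -/
theorem cuspForm_fortyEight_eq_zero_of_isBigO (S : CuspForm (Gamma0 48) 2)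
    (h : (⇑S) =O[atImInfty] fun τ : ℍ ↦ Real.exp (-2 * π * 6 * τ.im)) : S = 0 := by
  have hcard : Nat.card (𝒮ℒ ⧸ ((Gamma0 48 : Subgroup SL(2, ℤ)) : Subgroup (GL (Fin 2) ℝ)).subgroupOf 𝒮ℒ) = 96 := by
    rw [card_quotient_subgroupOf_eq_index]
    have h1 := index_gamma0_eq_gamma0Index_holds 48
    unfold index_gamma0_eq_gamma0Index at h1
    rw [h1, gamma0_data_48.1]
  have hcusp : Nat.card (CuspOrbits ((Gamma0 48 : Subgroup SL(2, ℤ)) : Subgroup (GL (Fin 2) ℝ))) = 12 := by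
    have h1 := numCusps_eq_nuInfty_holds 48
    unfold numCusps_eq_nuInfty numCusps at h1
    rw [h1, gamma0_data_48.2.1]
  have h0 := coe_eq_zero_of_isBigO_exp S h (by
    rw [hcard, hcusp]
    simp only [Int.reduceMul, Int.reduceToNat, Nat.reduceDiv, Nat.cast_ofNat]
    norm_num)
  exact DFunLike.ext' (h0.trans CuspForm.coe_zero.symm)

/-- **`S ∈ S₂(Γ₀(48))` with `S/q⁶` convergent at `i∞` vanishes.** [cite: DiamondShurman2005, Thm. 3.5.1] -/
theorem cuspForm_fortyEight_eq_zero_of_tendsto (S : CuspForm (Gamma0 48) 2) {c : ℂ}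
    (h : Tendsto (fun τ : ℍ ↦ S τ / Periodic.qParam 1 (τ : ℂ) ^ 6) atImInfty (𝓝 c)) : S = 0 := by
  refine cuspForm_fortyEight_eq_zero_of_isBigO S ?_
  have h1 : (fun τ : ℍ ↦ S τ / Periodic.qParam 1 (τ : ℂ) ^ 6) =O[atImInfty] fun _ : ℍ ↦ (1 : ℝ) :=
    h.isBigO_one ℝ
  have h2 : (fun τ : ℍ ↦ Periodic.qParam 1 (τ : ℂ) ^ 6) =O[atImInfty] fun τ : ℍ ↦ Real.exp (-2 * π * 6 * τ.im) := by
    refine Asymptotics.IsBigO.of_bound 1 (Filter.Eventually.of_forall fun τ ↦ ?_)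
    rw [norm_pow, Periodic.norm_qParam, Real.norm_eq_abs, abs_of_pos (Real.exp_pos _), one_mul,
      ← Real.exp_nat_mul, UpperHalfPlane.coe_im]
    apply le_of_eq
    congr 1
    ring
  have h3 := h1.mul h2
  simp only [one_mul] at h3
  refine h3.congr' (Filter.Eventually.of_forall fun τ ↦ ?_) EventuallyEq.rfl
  have hq : Periodic.qParam 1 (τ : ℂ) ≠ 0 := Complex.exp_ne_zero _
  show S τ / Periodic.qParam 1 (τ : ℂ) ^ 6 * Periodic.qParam 1 (τ : ℂ) ^ 6 = S τ
  rw [div_mul_cancel₀ _ (pow_ne_zero _ hq)]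

end Summit.BirchSwinnertonDyer.BirchSwinnertonDyer.Theorems.ManinLocalTwoThree.NewformFortyEight

end
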